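import Summits.Ventures.HSemireg.WedgeHankelRecurrenceGaussZerosTwoByTwoBounds

/-!
# Venture HSemireg — **THE RAYLEIGH BOUND WITH CONSTANT AMPLITUDES: `(t+1)·x_t ≥ Σ_{i≤t} a_i + 2 Σ_{j=1}^{t} √b_j` and `(t+1)·x_0 ≤ Σ_{i≤t} a_i − 2 Σ_{j=1}^{t} √b_j`** — the extreme zeros of
# `q_{t+1}` against the average row sum of the symmetrised Jacobi matrix `tridiag(√b, a, √b)` (test vectors `v_i = ±1∕√h_i` in the Favard coordinates)

HONEST FRAMING. Part of the Lean index of the computation cell `pub-hsemireg` (seat p10 gen 45, Sunday typer «UNIFORM-IN-n»).  Real polynomials, finite sums and `Real.sqrt` only; no variety, no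
cohomology theory, no sheaf, no Ext group and no semiregularity map is constructed here; nothing here says that HC / HC_CM / HC_AV holds; no Literature fact (unproved `Prop`) is declared or used.
Custodian versions as in `WedgeHankelSiegelIdeal` (1/3).
SOURCES (cited).  R. A. Horn, C. R. Johnson, *Matrix Analysis* (2nd ed.) Thm 4.2.2 (Rayleigh–Ritz) with the vector `(1, …, 1)` resp. `(1, −1, 1, …)`; M. E. H. Ismail, X. Li, *Bound on the extreme
zeros of orthogonal polynomials*, Proc. AMS 115 (1992) 131–140 (context: sharper chain-sequence bounds); G. Szegő, *Orthogonal Polynomials*, §6.2.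
PROOF TYPED HERE.  Favard pairing at the zeros (N323); for `v_i = s_i∕√h_i` (`s_i = ±1`) one has `Σ μ P_v² = t + 1` and `Σ μ x P_v² = Σ a_i + 2 Σ s_i s_{i+1} √b_{i+1}` (N323 `favard_x_pairing`,
`h_{i+1}∕(√h_i √h_{i+1}) = √b_{i+1}`); the Rayleigh quotient lies in `[x_0, x_t]`.
DEDUP DISCLOSURE (`rg -n 'mean_bound|row_sum|average' Summits/Ventures/HSemireg/WedgeHankelRecurrenceGauss*`, 2026-09-03): N329 (Gershgorin hull, diagonal entries), N330 (Newton-sum spread bounds),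
N361 (2×2 blocks); the constant-amplitude Rayleigh bounds are new.  The 3 names below: 0 hits tree-wide.

WHAT IS IN THE TREE.  N323 `favard_pairing_at_zeros`, `favard_x_pairing`, `weighted_sq_combination_expand`, `favard_norm_sq_combination`; N325 `prod_Ico_one_succ_succ`.
THIS FILE (namespace `Summit.Ventures.HSemireg.Wedge.HankelOuter` continued; CHAINED on N361 (import only); 0 definitions):
* §1127 `favard_forms_signed_unit` (norm `t + 1` and `x`-form `Σ a_i + 2 Σ s_i s_{i+1} √b_{i+1}` of `v_i = s_i∕√h_i`, `s_i² = 1`), **`top_zero_ge_mean_row_sum`** (`Σ a_i + 2 Σ √b_j ≤ (t+1) x_t`),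
  **`bottom_zero_le_mean_row_sum`** (`(t+1) x_0 ≤ Σ a_i − 2 Σ √b_j`).
CAVEATS.  Positive recurrences.  Nothing Ext-side.  New names only.
-/

open Module Polynomial
open scoped Matrix Polynomial

namespace Summit.Ventures.HSemireg.Wedge.HankelOuter

/-! ## §1127. Rayleigh bounds with constant amplitudes -/

/-- **The signed unit-amplitude vector in Favard coordinates**: for `v_i = s_i ∕ √h_i` with `s_i² = 1` (`h_i = b_1⋯b_i`), `Σ_k μ_k P_v(x_k)² = t + 1` and
`Σ_k μ_k x_k P_v(x_k)² = Σ_{i≤t} a_i + 2 Σ_{i<t} s_i s_{i+1} √b_{i+1}`. [this file, §1127] -/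
theorem favard_forms_signed_unit {q : ℕ → ℝ[X]} {a b : ℕ → ℝ} (hq0 : q 0 = 1) (hq1 : q 1 = Polynomial.X - C (a 0))
    (hrec : ∀ n, q (n + 2) = (Polynomial.X - C (a (n + 1))) * q (n + 1) - C (b (n + 1)) * q n) (hb : ∀ j, 0 < b j)
    {t : ℕ} {μ x : Fin (t + 1) → ℝ} (hxr : ∀ k, (q (t + 1)).eval (x k) = 0)
    (hpair : ∀ i j : Fin (t + 1), ∑ k, μ k * ((q i).eval (x k) * (q j).eval (x k)) = if i = j then ∏ l ∈ Finset.Ico 1 ((j : ℕ) + 1), b l else 0)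
    (s : ℕ → ℝ) (hs : ∀ i, s i ^ 2 = 1) (v : Fin (t + 1) → ℝ) (hv : ∀ i, v i = s i / Real.sqrt (∏ l ∈ Finset.Ico 1 ((i : ℕ) + 1), b l)) :
    ∑ k, μ k * ((∑ i : Fin (t + 1), C (v i) * q i).eval (x k)) ^ 2 = (t : ℝ) + 1 ∧
    ∑ k, μ k * (x k * ((∑ i : Fin (t + 1), C (v i) * q i).eval (x k)) ^ 2) = ∑ i ∈ Finset.range (t + 1), a i + 2 * ∑ i ∈ Finset.range t, s i * s (i + 1) * Real.sqrt (b (i + 1)) := by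
  have hH : ∀ n, 0 < ∏ l ∈ Finset.Ico 1 (n + 1), b l := fun n => Finset.prod_pos fun l _ => hb l
  have hsq : ∀ n, Real.sqrt (∏ l ∈ Finset.Ico 1 (n + 1), b l) ^ 2 = ∏ l ∈ Finset.Ico 1 (n + 1), b l := fun n => Real.sq_sqrt (hH n).le
  have hsq0 : ∀ n, 0 < Real.sqrt (∏ l ∈ Finset.Ico 1 (n + 1), b l) := fun n => Real.sqrt_pos.2 (hH n)
  -- diagonal and cross values
  have hdiag : ∀ i : Fin (t + 1), (∏ l ∈ Finset.Ico 1 ((i : ℕ) + 1), b l) * v i ^ 2 = 1 := fun i => by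
    rw [hv, div_pow, hs, hsq]; exact mul_div_cancel₀ _ (hH i).ne'
  have hcross : ∀ i j : Fin (t + 1), (i : ℕ) + 1 = j → v i * v j * ∏ l ∈ Finset.Ico 1 ((j : ℕ) + 1), b l = s i * s j * Real.sqrt (b j) := fun i j hij => by
    have hHj : ∏ l ∈ Finset.Ico 1 ((j : ℕ) + 1), b l = (∏ l ∈ Finset.Ico 1 ((i : ℕ) + 1), b l) * b j := by rw [← hij, prod_Ico_one_succ_succ b i]
    have hsj : Real.sqrt (∏ l ∈ Finset.Ico 1 ((j : ℕ) + 1), b l) = Real.sqrt (∏ l ∈ Finset.Ico 1 ((i : ℕ) + 1), b l) * Real.sqrt (b j) := by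
      rw [hHj, Real.sqrt_mul (hH i).le]
    have hb2 : Real.sqrt (b j) ^ 2 = b j := Real.sq_sqrt (hb j).le
    have key : ∀ S B si sj : ℝ, 0 < S → 0 < B → si / S * (sj / (S * B)) * (S ^ 2 * B ^ 2) = si * sj * B := fun S B si sj hS hB => by
      field_simp
    rw [hv, hv, hsj, hHj]
    calc s i / Real.sqrt (∏ l ∈ Finset.Ico 1 ((i : ℕ) + 1), b l) * (s j / (Real.sqrt (∏ l ∈ Finset.Ico 1 ((i : ℕ) + 1), b l) * Real.sqrt (b j))) *
          ((∏ l ∈ Finset.Ico 1 ((i : ℕ) + 1), b l) * b j)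
        = s i / Real.sqrt (∏ l ∈ Finset.Ico 1 ((i : ℕ) + 1), b l) * (s j / (Real.sqrt (∏ l ∈ Finset.Ico 1 ((i : ℕ) + 1), b l) * Real.sqrt (b j))) *
          (Real.sqrt (∏ l ∈ Finset.Ico 1 ((i : ℕ) + 1), b l) ^ 2 * Real.sqrt (b j) ^ 2) := by rw [hsq i, hb2]
      _ = s i * s j * Real.sqrt (b j) := key _ _ _ _ (hsq0 i) (Real.sqrt_pos.2 (hb j))
  have hev : ∀ z : ℝ, (∑ i : Fin (t + 1), C (v i) * q i).eval z = ∑ i : Fin (t + 1), v i * (q i).eval z := fun z => by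
    rw [eval_finsetSum]; exact Finset.sum_congr rfl fun i _ => by rw [eval_mul, eval_C]
  refine ⟨?_, ?_⟩
  · rw [favard_norm_sq_combination (h := fun n => ∏ l ∈ Finset.Ico 1 (n + 1), b l) hpair v, Finset.sum_congr rfl fun i _ => hdiag i]
    simp
  · simp_rw [hev]
    rw [weighted_sq_combination_expand μ x (fun (i : Fin (t + 1)) k => (q i).eval (x k)) v]
    -- termwise values
    have hterm : ∀ i j : Fin (t + 1), v i * v j * ∑ k, μ k * (x k * ((q i).eval (x k) * (q j).eval (x k))) =
        (if (i : ℕ) + 1 = j then s i * s j * Real.sqrt (b j) else 0) + (if i = j then a i else 0) + (if (j : ℕ) + 1 = i then s j * s i * Real.sqrt (b i) else 0) := fun i j => by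
      rw [favard_x_pairing hq0 hq1 hrec hxr hpair i j, mul_add, mul_add]
      congr 1
      congr 1
      · by_cases h1 : (i : ℕ) + 1 = j
        · rw [if_pos h1, if_pos h1, hcross i j h1]
        · rw [if_neg h1, if_neg h1, mul_zero]
      · by_cases h2 : i = j
        · subst h2; rw [if_pos rfl, if_pos rfl, show v i * v i * (a i * ∏ l ∈ Finset.Ico 1 ((i : ℕ) + 1), b l) = a i * ((∏ l ∈ Finset.Ico 1 ((i : ℕ) + 1), b l) * v i ^ 2) by ring, hdiag, mul_one]
        · rw [if_neg h2, if_neg (fun h => h2 (Fin.ext h)), mul_zero]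
      · by_cases h3 : (j : ℕ) + 1 = i
        · rw [if_pos h3.symm, if_pos h3, show v i * v j * ∏ l ∈ Finset.Ico 1 ((i : ℕ) + 1), b l = v j * v i * ∏ l ∈ Finset.Ico 1 ((i : ℕ) + 1), b l by ring, hcross j i h3]
        · rw [if_neg (fun h => h3 h.symm), if_neg h3, mul_zero]
    simp_rw [hterm, Finset.sum_add_distrib]
    -- the three double sums
    have hd : ∑ i : Fin (t + 1), ∑ j : Fin (t + 1), (if i = j then a i else 0) = ∑ i ∈ Finset.range (t + 1), a i := by
      rw [Finset.sum_range (fun i => a i)]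
      exact Finset.sum_congr rfl fun i _ => by simp only [Finset.sum_ite_eq, Finset.mem_univ, if_true]
    have hup : ∑ i : Fin (t + 1), ∑ j : Fin (t + 1), (if (i : ℕ) + 1 = j then s i * s j * Real.sqrt (b j) else 0) = ∑ i ∈ Finset.range t, s i * s (i + 1) * Real.sqrt (b (i + 1)) := by
      rw [Finset.sum_range (fun i => s i * s (i + 1) * Real.sqrt (b (i + 1)))]
      -- split the outer sum over `i ≤ t` into `i < t` and `i = t`
      rw [Fin.sum_univ_castSucc]
      have hlast : ∑ j : Fin (t + 1), (if ((Fin.last t : Fin (t + 1)) : ℕ) + 1 = j then s (Fin.last t) * s j * Real.sqrt (b j) else 0) = 0 :=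
        Finset.sum_eq_zero fun j _ => if_neg (by rw [Fin.val_last]; have := j.is_lt; omega)
      rw [hlast, add_zero]
      refine Finset.sum_congr rfl fun i _ => ?_
      rw [Finset.sum_eq_single (⟨(i : ℕ) + 1, by have := i.is_lt; omega⟩ : Fin (t + 1)) (fun j _ hj => if_neg (fun h => hj (Fin.ext (by simpa using h.symm)))) (fun h => absurd (Finset.mem_univ _) h)]
      simp
    have hlow : ∑ i : Fin (t + 1), ∑ j : Fin (t + 1), (if (j : ℕ) + 1 = i then s j * s i * Real.sqrt (b i) else 0) = ∑ i ∈ Finset.range t, s i * s (i + 1) * Real.sqrt (b (i + 1)) := by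
      rw [Finset.sum_comm]; exact hup
    rw [hup, hd, hlow]
    ring

/-- **`Σ_{i≤t} a_i + 2 Σ_{j=1}^{t} √b_j ≤ (t+1)·x_t`**: the largest zero is at least the average row sum of `tridiag(√b, a, √b)`. [Horn–Johnson Thm 4.2.2; this file, §1127] -/
theorem top_zero_ge_mean_row_sum {q : ℕ → ℝ[X]} {a b : ℕ → ℝ} (hq0 : q 0 = 1) (hq1 : q 1 = Polynomial.X - C (a 0))
    (hrec : ∀ n, q (n + 2) = (Polynomial.X - C (a (n + 1))) * q (n + 1) - C (b (n + 1)) * q n) (hb : ∀ j, 0 < b j)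
    {t : ℕ} {x : Fin (t + 1) → ℝ} (hx : StrictMono x) (hxq : q (t + 1) = ∏ j, (Polynomial.X - C (x j))) :
    ∑ i ∈ Finset.range (t + 1), a i + 2 * ∑ i ∈ Finset.range t, Real.sqrt (b (i + 1)) ≤ ((t : ℝ) + 1) * x (Fin.last t) := by
  obtain ⟨μ, hμ, hpair⟩ := favard_pairing_at_zeros hq0 hq1 hrec hb hx hxq
  have hxr : ∀ j, (q (t + 1)).eval (x j) = 0 := fun j => by
    rw [hxq, eval_prod]; exact Finset.prod_eq_zero (Finset.mem_univ j) (by rw [eval_sub, eval_X, eval_C, sub_self])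
  obtain ⟨v, hv⟩ : ∃ v : Fin (t + 1) → ℝ, v = fun (i : Fin (t + 1)) => (1 : ℝ) / Real.sqrt (∏ l ∈ Finset.Ico 1 ((i : ℕ) + 1), b l) := ⟨_, rfl⟩
  obtain ⟨hN, hF⟩ := favard_forms_signed_unit hq0 hq1 hrec hb hxr hpair (fun _ => 1) (fun _ => one_pow 2) v (fun i => by rw [hv])
  simp only [one_mul] at hF
  obtain ⟨P, hP⟩ : ∃ P : ℝ[X], P = ∑ i : Fin (t + 1), C (v i) * q i := ⟨_, rfl⟩
  rw [← hP] at hN hF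
  have hle : ∑ k, μ k * (x k * (P.eval (x k)) ^ 2) ≤ x (Fin.last t) * ∑ k, μ k * (P.eval (x k)) ^ 2 := sum_mul_node_mul_sq_le_last hx (fun k => (hμ k).le) P
  rw [hF, hN] at hle
  linarith

/-- **`(t+1)·x_0 ≤ Σ_{i≤t} a_i − 2 Σ_{j=1}^{t} √b_j`** (alternating amplitudes). [Horn–Johnson Thm 4.2.2; this file, §1127] -/
theorem bottom_zero_le_mean_row_sum {q : ℕ → ℝ[X]} {a b : ℕ → ℝ} (hq0 : q 0 = 1) (hq1 : q 1 = Polynomial.X - C (a 0))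
    (hrec : ∀ n, q (n + 2) = (Polynomial.X - C (a (n + 1))) * q (n + 1) - C (b (n + 1)) * q n) (hb : ∀ j, 0 < b j)
    {t : ℕ} {x : Fin (t + 1) → ℝ} (hx : StrictMono x) (hxq : q (t + 1) = ∏ j, (Polynomial.X - C (x j))) :
    ((t : ℝ) + 1) * x 0 ≤ ∑ i ∈ Finset.range (t + 1), a i - 2 * ∑ i ∈ Finset.range t, Real.sqrt (b (i + 1)) := by
  obtain ⟨μ, hμ, hpair⟩ := favard_pairing_at_zeros hq0 hq1 hrec hb hx hxq
  have hxr : ∀ j, (q (t + 1)).eval (x j) = 0 := fun j => by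
    rw [hxq, eval_prod]; exact Finset.prod_eq_zero (Finset.mem_univ j) (by rw [eval_sub, eval_X, eval_C, sub_self])
  obtain ⟨v, hv⟩ : ∃ v : Fin (t + 1) → ℝ, v = fun (i : Fin (t + 1)) => (-1 : ℝ) ^ (i : ℕ) / Real.sqrt (∏ l ∈ Finset.Ico 1 ((i : ℕ) + 1), b l) := ⟨_, rfl⟩
  obtain ⟨hN, hF⟩ := favard_forms_signed_unit hq0 hq1 hrec hb hxr hpair (fun i => (-1 : ℝ) ^ i) (fun i => by rw [← pow_mul, mul_comm, pow_mul, neg_one_sq, one_pow]) v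
    (fun i => by rw [hv])
  have hsign : ∀ i : ℕ, (-1 : ℝ) ^ i * (-1 : ℝ) ^ (i + 1) = -1 := fun i => by rw [pow_succ, ← mul_assoc, ← pow_add, ← two_mul, pow_mul, neg_one_sq, one_pow, one_mul]
  simp only [hsign, neg_one_mul, Finset.sum_neg_distrib, mul_neg] at hF
  obtain ⟨P, hP⟩ : ∃ P : ℝ[X], P = ∑ i : Fin (t + 1), C (v i) * q i := ⟨_, rfl⟩
  rw [← hP] at hN hF
  have hle : x 0 * ∑ k, μ k * (P.eval (x k)) ^ 2 ≤ ∑ k, μ k * (x k * (P.eval (x k)) ^ 2) := by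
    rw [Finset.mul_sum]
    refine Finset.sum_le_sum fun k _ => ?_
    rw [mul_left_comm]
    exact mul_le_mul_of_nonneg_left (mul_le_mul_of_nonneg_right (hx.monotone (Fin.zero_le k)) (sq_nonneg _)) (hμ k).le
  rw [hF, hN] at hle
  linarith

end Summit.Ventures.HSemireg.Wedge.HankelOuter
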